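import Mathlib
import HarnessLib

/-!
# Grading a localisation `k[x][u⁻¹]` at a weighted-homogeneous element `u` of weight `0`
(generic tool for the V-BR chart data of the peeled specimens — crux stmt-ResolutionOfSingularities-15640
`WildQuotients.WildQuotientResolution`, line `Sketch`; S1 = stmt-ResolutionOfSingularities-17941; chain w45c card-P
specimen «peeled 𝔸⁴/ℤ9», V-BR, brick Z4T part 3b «the `μ₄`-grading of `L = k[x][u⁻¹]`», res-L1-w45c-stub-2
`Z4T-PART3-DESIGN.md`). [OURS · L1 W4.5c] — NOT a statement of any manuscript; AI-produced, kernel-checked ≠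
expert-reviewed. Def-free (the grading is produced as an `∃`, in the style of
`TameTransfer.exists_gradedAlgebra_fixedPoints_zpowers`).

For a weight `w : σ → M` (`M` any additive commutative monoid with decidable equality — e.g. `ZMod 4`), a field
`k` and a NON-ZERO polynomial `u ∈ k[x_σ]` that is weighted-homogeneous OF WEIGHT `0`:

* `weightedHomogeneousComponent_mul_of_weight_zero` — `(f·v)_i = f_i · v` for `v` homogeneous of weight `0`;
* **`exists_gradedAlgebra_localizationAway`** — `L = Localization.Away u` carries a `GradedAlgebra 𝓛` by `M` with
  `y ∈ 𝓛 i ↔ ∃ m f, f` weighted-homogeneous of weight `i ∧ y = ι f · (u⁻¹)^m` (pieces = homogeneous fractions;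
  they span since `y = ι r · u⁻ᵐ` and `r = Σ rᵢ`; they are independent because `ι` is injective, denominators can
  be cleared by the weight-`0` element `u`, and the pieces of `k[x]` are independent).
With `σ̃` weight-preserving this feeds `TameTransfer.exists_gradedAlgebra_fixedPoints_zpowers` (the `GradedAlgebra`
conjunct of the per-piece chart datum of `PeelingFrame.hasResolution_glued_liftAction_of_pieceGradedCharts`).
-/

-- single-problem summit: the doubled namespace component `ResolutionOfSingularities` is forced
set_option linter.dupNamespace false

noncomputable section

open MvPolynomial DirectSum

namespace Summit.ResolutionOfSingularities.ResolutionOfSingularities.Theorems.WildQuotientResolution.TameTransfer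

variable {σ M : Type} [AddCommMonoid M] [DecidableEq M] {R : Type} [CommRing R]

/-- **`(f · v)_i = f_i · v`** for `v` weighted-homogeneous of weight `0`. [folklore] -/
theorem weightedHomogeneousComponent_mul_of_weight_zero (w : σ → M) (i : M) (f v : MvPolynomial σ R)
    (hv : IsWeightedHomogeneous w v 0) :
    weightedHomogeneousComponent w i (f * v) = weightedHomogeneousComponent w i f * v := by
  classical
  set S := (weightedHomogeneousComponent_finsupp (w := w) f).toFinset with hS
  have hf : f = ∑ m ∈ S, weightedHomogeneousComponent w m f := by
    conv_lhs => rw [← sum_weightedHomogeneousComponent w f]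
    exact finsum_eq_sum _ (weightedHomogeneousComponent_finsupp f)
  have hcomp : ∀ m, weightedHomogeneousComponent w i (weightedHomogeneousComponent w m f * v) =
      if i = m then weightedHomogeneousComponent w m f * v else 0 := by
    intro m
    have hmem : weightedHomogeneousComponent w m f * v ∈ weightedHomogeneousSubmodule R w m := by
      have h := (weightedHomogeneousComponent_isWeightedHomogeneous (w := w) m f).mul hv
      rw [add_zero] at h
      exact (mem_weightedHomogeneousSubmodule R w m _).mpr h
    exact weightedHomogeneousComponent_of_mem hmem
  calc weightedHomogeneousComponent w i (f * v)
      = weightedHomogeneousComponent w i (∑ m ∈ S, weightedHomogeneousComponent w m f * v) := by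
        rw [← Finset.sum_mul, ← hf]
    _ = ∑ m ∈ S, weightedHomogeneousComponent w i (weightedHomogeneousComponent w m f * v) :=
        map_sum _ _ _
    _ = ∑ m ∈ S, (if i = m then weightedHomogeneousComponent w m f * v else 0) :=
        Finset.sum_congr rfl (fun m _ => hcomp m)
    _ = if i ∈ S then weightedHomogeneousComponent w i f * v else 0 := Finset.sum_ite_eq S i _
    _ = weightedHomogeneousComponent w i f * v := by
        split_ifs with hi
        · rfl
        · have h0 : weightedHomogeneousComponent w i f = 0 := by
            by_contra hne
            exact hi ((Set.Finite.mem_toFinset _).mpr hne)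
          rw [h0, zero_mul]

-- the four submodule/monoid/span/independence arguments over one `let`; head-room
set_option maxHeartbeats 1600000 in
/-- **Grading of `k[x][u⁻¹]` by homogeneous fractions**, `u ≠ 0` weighted-homogeneous of weight `0`.
[OURS · L1 W4.5c] -/
theorem exists_gradedAlgebra_localizationAway {k : Type} [Field k] (w : σ → M) (u : MvPolynomial σ k)
    (hu : IsWeightedHomogeneous w u 0) (hu0 : u ≠ 0) :
    ∃ (𝓛 : M → Submodule k (Localization.Away u)) (_ : GradedAlgebra 𝓛),
      ∀ (i : M) (y : Localization.Away u), y ∈ 𝓛 i ↔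
        ∃ (m : ℕ) (f : MvPolynomial σ k), IsWeightedHomogeneous w f i ∧
          y = algebraMap (MvPolynomial σ k) (Localization.Away u) f * IsLocalization.Away.invSelf u ^ m := by
  classical
  set L := Localization.Away u
  set ι := algebraMap (MvPolynomial σ k) (Localization.Away u) with hι
  set J : Localization.Away u := IsLocalization.Away.invSelf u with hJdef
  have h1 : ι u * J = 1 := IsLocalization.Away.mul_invSelf u
  have hpow : ∀ m : ℕ, ι u ^ m * J ^ m = 1 := fun m => by rw [← mul_pow, h1, one_pow]
  have hinj : Function.Injective ι :=
    IsLocalization.injective (Localization.Away u) (powers_le_nonZeroDivisors_of_noZeroDivisors hu0)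
  -- clearing denominators: `ι f · J^m = ι (f u^a) · J^(m+a)`
  have hshift : ∀ (f : MvPolynomial σ k) (m a : ℕ), ι f * J ^ m = ι (f * u ^ a) * J ^ (m + a) := by
    intro f m a
    rw [map_mul, map_pow, pow_add]
    linear_combination (-(ι f * J ^ m)) * hpow a
  have hwu : ∀ a : ℕ, IsWeightedHomogeneous w (u ^ a) 0 := fun a => by
    have h := hu.pow a
    rwa [nsmul_zero] at h
  have hmulu : ∀ (f : MvPolynomial σ k) (i : M) (a : ℕ), IsWeightedHomogeneous w f i →
      IsWeightedHomogeneous w (f * u ^ a) i := fun f i a hf => by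
    have h := hf.mul (hwu a); rwa [add_zero] at h
  -- the pieces
  let 𝓛 : M → Submodule k L := fun i =>
    { carrier := {y | ∃ (m : ℕ) (f : MvPolynomial σ k), IsWeightedHomogeneous w f i ∧ y = ι f * J ^ m}
      zero_mem' := ⟨0, 0, isWeightedHomogeneous_zero _ _ _, by rw [map_zero, zero_mul]⟩
      add_mem' := by
        rintro _ _ ⟨m₁, f₁, hf₁, rfl⟩ ⟨m₂, f₂, hf₂, rfl⟩
        refine ⟨m₁ + m₂, f₁ * u ^ m₂ + f₂ * u ^ m₁, (hmulu f₁ _ m₂ hf₁).add (hmulu f₂ _ m₁ hf₂), ?_⟩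
        rw [hshift f₁ m₁ m₂, hshift f₂ m₂ m₁, add_comm m₂ m₁, map_add, add_mul]
      smul_mem' := by
        rintro c _ ⟨m, f, hf, rfl⟩
        refine ⟨m, C c * f, hf.C_mul c, ?_⟩
        rw [Algebra.smul_def, map_mul, IsScalarTower.algebraMap_apply k (MvPolynomial σ k) L c,
          MvPolynomial.algebraMap_eq, mul_assoc] }
  have hmem : ∀ (i : M) (y : L), y ∈ 𝓛 i ↔
      ∃ (m : ℕ) (f : MvPolynomial σ k), IsWeightedHomogeneous w f i ∧ y = ι f * J ^ m := fun i y => Iff.rfl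
  -- graded monoid
  haveI : SetLike.GradedMonoid 𝓛 :=
    { one_mem := (hmem 0 1).mpr ⟨0, 1, isWeightedHomogeneous_one _ _, by rw [map_one, pow_zero, mul_one]⟩
      mul_mem := fun {i j} a b ha hb => by
        obtain ⟨m₁, f₁, hf₁, rfl⟩ := (hmem i a).mp ha
        obtain ⟨m₂, f₂, hf₂, rfl⟩ := (hmem j b).mp hb
        exact (hmem (i + j) _).mpr ⟨m₁ + m₂, f₁ * f₂, hf₁.mul hf₂, by rw [map_mul, pow_add]; ring⟩ }
  -- every element is `ι r · J^m`
  have hsurj : ∀ y : L, ∃ (r : MvPolynomial σ k) (m : ℕ), y = ι r * J ^ m := by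
    intro y
    obtain ⟨⟨r, ⟨s, ⟨m, rfl⟩⟩⟩, hy⟩ := IsLocalization.surj (Submonoid.powers u) y
    refine ⟨r, m, ?_⟩
    have e : y = y * (ι u * J) ^ m := by rw [h1, one_pow, mul_one]
    rw [e, mul_pow, ← mul_assoc, ← map_pow]
    exact congrArg (· * J ^ m) hy
  -- the pieces span
  have htop : ⨆ i, 𝓛 i = ⊤ := by
    rw [eq_top_iff]
    rintro y -
    obtain ⟨r, m, rfl⟩ := hsurj y
    have hr : r = ∑ i ∈ (weightedHomogeneousComponent_finsupp (w := w) r).toFinset,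
        weightedHomogeneousComponent w i r := by
      conv_lhs => rw [← sum_weightedHomogeneousComponent w r]
      exact finsum_eq_sum _ (weightedHomogeneousComponent_finsupp r)
    rw [hr, map_sum, Finset.sum_mul]
    exact Submodule.sum_mem _ fun i _ => Submodule.mem_iSup_of_mem i
      ((hmem i _).mpr ⟨m, _, weightedHomogeneousComponent_isWeightedHomogeneous i r, rfl⟩)
  -- independence: an element of `⨆ j ≠ i, 𝓛 j` is `ι g · J^m` with `g_i = 0`
  have hT : ∀ i : M, ∀ y ∈ ⨆ j ≠ i, 𝓛 j, ∃ (m : ℕ) (g : MvPolynomial σ k),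
      weightedHomogeneousComponent w i g = 0 ∧ y = ι g * J ^ m := by
    intro i y hy
    refine Submodule.iSup_induction (p := fun j => ⨆ (_ : j ≠ i), 𝓛 j)
      (motive := fun y => ∃ (m : ℕ) (g : MvPolynomial σ k),
        weightedHomogeneousComponent w i g = 0 ∧ y = ι g * J ^ m) hy ?_ ?_ ?_
    · intro j y hy
      by_cases hji : j = i
      · subst hji
        rw [iSup_neg (fun h => h rfl), Submodule.mem_bot] at hy
        exact ⟨0, 0, map_zero _, by rw [hy, map_zero, zero_mul]⟩
      · rw [iSup_pos hji] at hy
        obtain ⟨m, f, hf, rfl⟩ := (hmem j y).mp hy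
        exact ⟨m, f, hf.weightedHomogeneousComponent_ne i (Ne.symm hji), rfl⟩
    · exact ⟨0, 0, map_zero _, by rw [map_zero, zero_mul]⟩
    · rintro _ _ ⟨m₁, g₁, hg₁, rfl⟩ ⟨m₂, g₂, hg₂, rfl⟩
      refine ⟨m₁ + m₂, g₁ * u ^ m₂ + g₂ * u ^ m₁, ?_, ?_⟩
      · rw [map_add, weightedHomogeneousComponent_mul_of_weight_zero w i g₁ _ (hwu m₂),
          weightedHomogeneousComponent_mul_of_weight_zero w i g₂ _ (hwu m₁), hg₁, hg₂, zero_mul,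
          zero_mul, add_zero]
      · rw [hshift g₁ m₁ m₂, hshift g₂ m₂ m₁, add_comm m₂ m₁, map_add, add_mul]
  have hind : iSupIndep 𝓛 := by
    intro i
    rw [disjoint_iff_inf_le]
    rintro y ⟨hy1, hy2⟩
    obtain ⟨m, f, hf, rfl⟩ := (hmem i y).mp hy1
    obtain ⟨m', g, hg, hyg⟩ := hT i _ hy2
    -- clear denominators: `f u^{m'} = g u^{m}` in `k[x]`
    have e : ι (f * u ^ m') = ι (g * u ^ m) := by
      have e1 : ι (f * u ^ m') * J ^ (m + m') = ι (g * u ^ m) * J ^ (m' + m) := by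
        rw [← hshift f m m', ← hshift g m' m]; exact hyg
      have hJu : IsUnit (J ^ (m + m')) := (IsUnit.of_mul_eq_one_right (ι u) h1).pow _
      rw [add_comm m' m] at e1
      exact hJu.mul_left_injective e1
    have e2 : f * u ^ m' = g * u ^ m := hinj e
    have e3 : f * u ^ m' = 0 := by
      have h := congrArg (weightedHomogeneousComponent w i) e2
      rwa [(hmulu f i m' hf).weightedHomogeneousComponent_same,
        weightedHomogeneousComponent_mul_of_weight_zero w i g _ (hwu m), hg, zero_mul] at h
    have hf0 : f = 0 := (mul_eq_zero.mp e3).resolve_right (pow_ne_zero m' hu0)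
    rw [Submodule.mem_bot, hf0, map_zero, zero_mul]
  have hint : IsInternal 𝓛 := (isInternal_submodule_iff_iSupIndep_and_iSup_eq_top 𝓛).mpr ⟨hind, htop⟩
  exact ⟨𝓛, hint.gradedAlgebra, hmem⟩

end Summit.ResolutionOfSingularities.ResolutionOfSingularities.Theorems.WildQuotientResolution.TameTransfer

end
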